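import Summits.QuantumFields.BalabanUV.T4Continuum.Support.ShellMeasureAverageAnalytic
import Literature.Analysis.Complex.RungeUnits

/-!
# `T4Continuum.ShellMeasureAverageLipschitz` — WALL §3 W-d, ANALYTIC HALF WITHOUT SCHWARZ (generic core, part 1):
# TELESCOPED unit-valued bond words (`‖f B − f 0‖ ≤ e^{w‖B‖} − 1`), the series logarithm is `1∕(1−r)`-Lipschitz on
# `{‖X − 1‖ ≤ r}`, and `‖e^X − e^Y‖ ≤ e^{max ‖·‖}·‖X − Y‖` — the three devices that replace S49 f1's Schwarz-at-`0`
(cell `pub-balaban`, sub-cell `t4`, spine estimate NE7c (node U5b); NE7c ROUND-2 crew `t4-ne7c-formalise-*`, seat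
`b2b-balaban-t4-ne7c-formalise-leaf-06` gen 8, own-initiative OFFER «γ9″ THE W-d WINDOW WITHOUT SCHWARZ» (journal
`HOME/CLAIMS.log` l.20097, answering owner ruling R-ne7cp1-g34-4 (b) «improving `2816(d+1)L` (unit-word bounds + Schwarz
at 0) is the lever»; ROW S100 f1a by R-ne7cp1-g35-1 (c)); imports S49 f1 `ShellMeasureAverageAnalytic` (for `ExpWord`, `expU`,
`mlog`) and `Literature.Analysis.Complex.RungeUnits` (for the tree's `norm_pow_succ_sub_pow_succ_le`, `norm_exp_sub_exp_le`) ONLY;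
[folklore] elementary analysis in a complete normed algebra; ONE `structure … : Prop` (`LipWord` = S49 f1's `ExpWord` + the
two telescoping bounds; bundles elementary facts about one map, names no wall binder), 0 `def … : Prop` hypothesis,
0 sorry, 0 citations)

HONEST FRAMING.  Finite four-torus programme, rung (B)+1 only — NOT infinite volume, NOT a mass gap, NOT the Clay
problem, NOT summit progress; (B), `BetaPertHyp`, (B^μ) are not consumed.  NE7c (`T4IndicatorShell.ShellWeightBound`)
is NOT PRINTED and NOT PROVED; «NE7c ⇐ the named binders».  This file (with part 2 `ShellMeasureAverageLipschitzChart`)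
sharpens OUR OWN constants — S49 f1∕f2's analyticity radius `R = 1∕(2816(d+1)L)` of the printed block average in the
chart; [Balaban1987RG1] p. 267 prints NO radius («for U in a small neighbourhood …»): nothing printed is asserted,
quantified or disputed; NOTHING in the countdown moves; spine PROVED 0∕9.  HONEST DEPENDENCY (cell, verbatim): continuum
YM on T⁴ ⇐ BetaPertH ∧ nine spine estimates (0/9 proved); BetaPertH ⇐ (D1) ∧ (D4) ∧ CAP+tail; G-an2-4 gates asym, D1
and NE2/3/4.

THE POINT.  S49 f1 (`ShellMeasureAverageAnalytic`) bounds the motion of a word and of the quotient `Z` by SCHWARZ AT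
THE ORIGIN from crude sup bounds (`‖f B − f 0‖ ≤ ((e^{wR₀}+1)∕R₀)‖B‖`, `‖Z − 1‖ ≤ ((e^{2+w_T R₁}+1)∕R₁)‖B‖`), which
costs the two radius divisions `R₀ = 1∕w → R₁ = 1∕(32w) → R = 1∕(1408w)`.  The replacement devices, with no division
by a radius:
* §0 the one series inequality not yet in the light cone: **`norm_mlog_sub_mlog_le`** `‖log X − log Y‖ ≤ ‖X − Y‖∕(1 − r)`
  for `‖X − 1‖, ‖Y − 1‖ ≤ r < 1` (termwise comparison of the series (21) of [Balaban1985Averaging] with the real geometric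
  series, through the tree's `Literature.Analysis.Complex.norm_pow_succ_sub_pow_succ_le`; the same inequality is
  `TermwiseBackground.norm_mlog_sub_mlog_le` (NE7 term-wise chain, `·(1−r)⁻¹` form) and
  `FederbushMean.norm_mlog_sub_mlog_le` (`(1 + r∕(1−r))·` form) — re-derived here in 20 lines to keep this file's import
  cone at S49 f1 + `RungeUnits`); `‖e^X − e^Y‖ ≤ ‖X − Y‖·e^{max(‖X‖,‖Y‖)}` is the tree's
  `Literature.Analysis.Complex.norm_exp_sub_exp_le` (used in part 2).
* §1 **`LipWord f w`** := S49 f1's `ExpWord f w` AND `‖f B − f 0‖ ≤ e^{w‖B‖} − 1`, `‖(f B)⁻¹ − (f 0)⁻¹‖ ≤ e^{w‖B‖} − 1`;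
  closed under `const`, `one`, `mono`, `inv`, **`mul`** (weights add — `norm_mul_sub_mul_le`:
  `‖pq − p₀q₀‖ ≤ ‖p‖‖q − q₀‖ + ‖p − p₀‖‖q₀‖ ≤ e^{α}(e^{β} − 1) + (e^{α} − 1) = e^{α+β} − 1`), `listProd`, `pathProd`
  (`B7Eq61Linearization.pathProd`); **`expFactor`**: the perturbed bond variable `B ↦ e^{iℓ(B)}v` (`‖ℓ B‖ ≤ ‖B‖`,
  `‖v‖, ‖v⁻¹‖ ≤ 1`) is a `LipWord` of weight `1` (`‖e^{a} − 1‖ ≤ e^{‖a‖} − 1`, the tree's `norm_exp_sub_one_le`).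
Part 2 (`ShellMeasureAverageLipschitzChart`): the exponent, the quotient and the chart average `F = (−i)·log Z`, sharp.
The instance for the printed average [B7] (15) (`R♯ = 1∕(16(d+1)L)`, `‖Q̃‖ ≤ 1∕2`) is `ShellMeasureAverageAnalyticB7Sharp`.
-/

noncomputable section

open NormedSpace Metric Set

namespace Summit.QuantumFields.BalabanUV.T4Continuum.ShellMeasureAverageLipschitz

open Literature.MathematicalPhysics.QuantumFieldTheory.Balaban1983to89
open B12AverageCorridor267 (expU val_expU val_inv_expU)
open B7Eq61Linearization (pathProd pathProd_zero pathProd_succ)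
open MatrixLog (mlog analyticAt_mlog mlog_one hasSum_mlog norm_mlog_le_div norm_mlog_le_neg_log norm_logSeriesCoeff_succ)
open Literature.Analysis.Calculus (norm_exp_sub_one_le)
open Literature.Analysis.Complex (logSeriesCoeff)
open ShellMeasureAverageAnalytic

variable {E : Type*} [NormedAddCommGroup E] [NormedSpace ℂ E]
variable {𝔸 : Type*} [NormedRing 𝔸] [NormedAlgebra ℂ 𝔸]

/-! ## §0 The series logarithm is `1∕(1−r)`-Lipschitz on `{‖X − 1‖ ≤ r}` -/

section Series

variable [CompleteSpace 𝔸] [NormOneClass 𝔸]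

/-- **THE SERIES LOGARITHM IS `1∕(1−r)`-LIPSCHITZ ON `{‖X − 1‖ ≤ r}`** (`r < 1`): `‖log X − log Y‖ ≤ ‖X − Y‖∕(1 − r)`
(termwise: `‖cₙ‖ = 1∕n`, `‖(X−1)ⁿ − (Y−1)ⁿ‖ ≤ n rⁿ⁻¹‖X − Y‖` by the tree's `norm_pow_succ_sub_pow_succ_le`, `Σ rⁿ⁻¹ = 1∕(1−r)`;
the same inequality as `TermwiseBackground.norm_mlog_sub_mlog_le` ∕ `FederbushMean.norm_mlog_sub_mlog_le`, re-derived to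
keep the import cone small). [folklore] -/
theorem norm_mlog_sub_mlog_le {X Y : 𝔸} {r : ℝ} (hr : r < 1) (hX : ‖X - 1‖ ≤ r) (hY : ‖Y - 1‖ ≤ r) :
    ‖mlog X - mlog Y‖ ≤ ‖X - Y‖ / (1 - r) := by
  have hr0 : 0 ≤ r := (norm_nonneg _).trans hX
  have h1 := hasSum_mlog (hX.trans_lt hr)
  have h2 := hasSum_mlog (hY.trans_lt hr)
  have h3 : HasSum (fun n : ℕ => logSeriesCoeff n • ((X - 1) ^ n - (Y - 1) ^ n)) (mlog X - mlog Y) := by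
    simpa only [smul_sub] using h1.sub h2
  have h3' : HasSum (fun n : ℕ => logSeriesCoeff (n + 1) • ((X - 1) ^ (n + 1) - (Y - 1) ^ (n + 1)))
      (mlog X - mlog Y) := by
    have h := (hasSum_nat_add_iff' 1).mpr h3
    simpa using h
  have h4 : HasSum (fun n : ℕ => r ^ n * ‖X - Y‖) (‖X - Y‖ / (1 - r)) := by
    have h := (hasSum_geometric_of_lt_one hr0 hr).mul_right ‖X - Y‖
    rwa [div_eq_mul_inv, mul_comm ‖X - Y‖]
  refine h3'.norm_le_of_bounded h4 fun n => ?_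
  have hXY : (X - 1) - (Y - 1) = X - Y := by abel
  have hn : (0 : ℝ) < n + 1 := by positivity
  have hmax : max ‖X - 1‖ ‖Y - 1‖ ≤ r := max_le hX hY
  have hpow : ‖(X - 1) ^ (n + 1) - (Y - 1) ^ (n + 1)‖ ≤ (n + 1) * r ^ n * ‖(X - 1) - (Y - 1)‖ :=
    (Literature.Analysis.Complex.norm_pow_succ_sub_pow_succ_le (X - 1) (Y - 1) n).trans
      (mul_le_mul_of_nonneg_right (mul_le_mul_of_nonneg_left
        (pow_le_pow_left₀ (le_max_of_le_left (norm_nonneg _)) hmax n) (by positivity)) (norm_nonneg _))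
  calc ‖logSeriesCoeff (n + 1) • ((X - 1) ^ (n + 1) - (Y - 1) ^ (n + 1))‖
      ≤ ‖logSeriesCoeff (n + 1)‖ * ‖(X - 1) ^ (n + 1) - (Y - 1) ^ (n + 1)‖ := norm_smul_le _ _
    _ ≤ (1 / (n + 1)) * ((n + 1) * r ^ n * ‖(X - 1) - (Y - 1)‖) :=
        mul_le_mul (le_of_eq (norm_logSeriesCoeff_succ n)) hpow (norm_nonneg _) (by positivity)
    _ = r ^ n * ‖X - Y‖ := by rw [hXY]; field_simp

end Series

/-! ## §1 Telescoped unit-valued words -/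

/-- A TELESCOPED UNIT-VALUED ENTIRE FAMILY of weight `w ≥ 0`: S49 f1's `ExpWord f w` (value and inverse value analytic
everywhere, `‖f B‖, ‖(f B)⁻¹‖ ≤ e^{w‖B‖}`) together with the two telescoping bounds `‖f B − f 0‖ ≤ e^{w‖B‖} − 1`,
`‖(f B)⁻¹ − (f 0)⁻¹‖ ≤ e^{w‖B‖} − 1` (the shape of every finite ordered product of perturbed bond variables
`(e^{iB′(b)}V(b))^{±1}`, `‖V(b)‖, ‖V(b)⁻¹‖ ≤ 1`).  Bundles elementary facts about one map; names no wall binder.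
[folklore] -/
@[folklore]
structure LipWord (f : E → 𝔸ˣ) (w : ℝ) : Prop where
  /-- the underlying `ExpWord` (analyticity and exponential bounds) -/
  expWord : ExpWord f w
  /-- telescoping bound on the value -/
  sub_le : ∀ B, ‖((f B : 𝔸ˣ) : 𝔸) - ((f 0 : 𝔸ˣ) : 𝔸)‖ ≤ Real.exp (w * ‖B‖) - 1
  /-- telescoping bound on the inverse value -/
  inv_sub_le : ∀ B, ‖(((f B)⁻¹ : 𝔸ˣ) : 𝔸) - (((f 0)⁻¹ : 𝔸ˣ) : 𝔸)‖ ≤ Real.exp (w * ‖B‖) - 1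

omit [NormedSpace ℂ E] [NormedAlgebra ℂ 𝔸] in
/-- The product step of the telescoping: `‖p‖ ≤ e^{α}`, `‖q₀‖ ≤ 1`, `‖p − p₀‖ ≤ e^{α} − 1`, `‖q − q₀‖ ≤ e^{β} − 1` ⟹
`‖pq − p₀q₀‖ ≤ e^{α+β} − 1` (`pq − p₀q₀ = p(q − q₀) + (p − p₀)q₀`). [folklore] -/
theorem norm_mul_sub_mul_le {p q p₀ q₀ : 𝔸} {α β : ℝ} (hα : 0 ≤ α) (hp : ‖p‖ ≤ Real.exp α) (hq₀ : ‖q₀‖ ≤ 1)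
    (hdp : ‖p - p₀‖ ≤ Real.exp α - 1) (hdq : ‖q - q₀‖ ≤ Real.exp β - 1) :
    ‖p * q - p₀ * q₀‖ ≤ Real.exp (α + β) - 1 := by
  have key : p * q - p₀ * q₀ = p * (q - q₀) + (p - p₀) * q₀ := by rw [mul_sub, sub_mul]; abel
  have h1 : 0 ≤ Real.exp α - 1 := by linarith [Real.one_le_exp hα]
  rw [key]
  calc ‖p * (q - q₀) + (p - p₀) * q₀‖ ≤ ‖p‖ * ‖q - q₀‖ + ‖p - p₀‖ * ‖q₀‖ :=
        (norm_add_le _ _).trans (add_le_add (norm_mul_le _ _) (norm_mul_le _ _))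
    _ ≤ Real.exp α * (Real.exp β - 1) + (Real.exp α - 1) * 1 :=
        add_le_add (mul_le_mul hp hdq (norm_nonneg _) (Real.exp_pos α).le)
          (mul_le_mul hdp hq₀ (norm_nonneg _) h1)
    _ = Real.exp (α + β) - 1 := by rw [Real.exp_add]; ring

namespace LipWord

variable {f g : E → 𝔸ˣ} {a b w : ℝ}

/-- An `ExpWord` has `‖f 0‖ ≤ 1`. [folklore] -/
theorem norm_apply_zero_le (hf : ExpWord f w) : ‖((f 0 : 𝔸ˣ) : 𝔸)‖ ≤ 1 := by
  simpa using hf.le 0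

/-- … and `‖(f 0)⁻¹‖ ≤ 1`. [folklore] -/
theorem norm_inv_apply_zero_le (hf : ExpWord f w) : ‖(((f 0)⁻¹ : 𝔸ˣ) : 𝔸)‖ ≤ 1 := by
  simpa using hf.le_inv 0

/-- A constant unit of norm `≤ 1` with inverse of norm `≤ 1` is a `LipWord` of weight `0`. [folklore] -/
theorem const {v : 𝔸ˣ} (h1 : ‖(v : 𝔸)‖ ≤ 1) (h2 : ‖((v⁻¹ : 𝔸ˣ) : 𝔸)‖ ≤ 1) : LipWord (fun _ : E => v) 0 where
  expWord := ExpWord.const h1 h2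
  sub_le B := by simp
  inv_sub_le B := by simp

/-- The unit `1` (needs `‖1‖ = 1`). [folklore] -/
theorem one [NormOneClass 𝔸] : LipWord (fun _ : E => (1 : 𝔸ˣ)) 0 :=
  const (by rw [Units.val_one, norm_one]) (by rw [inv_one, Units.val_one, norm_one])

/-- Increasing the weight. [folklore] -/
theorem mono (hf : LipWord f a) (hab : a ≤ b) : LipWord f b where
  expWord := hf.expWord.mono hab
  sub_le B := (hf.sub_le B).trans (sub_le_sub_right
    (Real.exp_le_exp.2 (mul_le_mul_of_nonneg_right hab (norm_nonneg B))) 1)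
  inv_sub_le B := (hf.inv_sub_le B).trans (sub_le_sub_right
    (Real.exp_le_exp.2 (mul_le_mul_of_nonneg_right hab (norm_nonneg B))) 1)

/-- Inverses: same weight. [folklore] -/
theorem inv (hf : LipWord f a) : LipWord (fun B => (f B)⁻¹) a where
  expWord := hf.expWord.inv
  sub_le := hf.inv_sub_le
  inv_sub_le B := by simp only [inv_inv]; exact hf.sub_le B

/-- **Products: the weights add** (`norm_mul_sub_mul_le` for the value, and for the inverse value with the factors
reversed, `(fg)⁻¹ = g⁻¹f⁻¹`). [folklore] -/
theorem mul (hf : LipWord f a) (hg : LipWord g b) : LipWord (fun B => f B * g B) (a + b) where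
  expWord := hf.expWord.mul hg.expWord
  sub_le B := by
    rw [Units.val_mul, Units.val_mul, add_mul]
    exact norm_mul_sub_mul_le (mul_nonneg hf.expWord.nonneg (norm_nonneg B)) (hf.expWord.le B)
      (norm_apply_zero_le hg.expWord) (hf.sub_le B) (hg.sub_le B)
  inv_sub_le B := by
    rw [mul_inv_rev, mul_inv_rev, Units.val_mul, Units.val_mul, add_mul, add_comm (a * ‖B‖)]
    exact norm_mul_sub_mul_le (mul_nonneg hg.expWord.nonneg (norm_nonneg B)) (hg.expWord.le_inv B)
      (norm_inv_apply_zero_le hf.expWord) (hg.inv_sub_le B) (hf.inv_sub_le B)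

/-- List products: the weights add up. [folklore] -/
theorem listProd [NormOneClass 𝔸] {ι : Type*} (F : ι → E → 𝔸ˣ) (wt : ι → ℝ) :
    ∀ l : List ι, (∀ i ∈ l, LipWord (F i) (wt i)) →
      LipWord (fun B => (l.map fun i => F i B).prod) (l.map wt).sum
  | [], _ => by
    simp only [List.map_nil, List.prod_nil, List.sum_nil]
    exact one
  | i :: l, h => by
    simp only [List.map_cons, List.prod_cons, List.sum_cons]
    exact (h i List.mem_cons_self).mul (listProd F wt l fun j hj => h j (List.mem_cons_of_mem i hj))

/-- `B7Eq61Linearization.pathProd` (ordered product of the first `n` factors): weight `n·w`. [folklore] -/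
theorem pathProd [NormOneClass 𝔸] {G : E → ℕ → 𝔸ˣ} (h : ∀ t, LipWord (fun B => G B t) w) :
    ∀ n : ℕ, LipWord (fun B => B7Eq61Linearization.pathProd (G B) n) (n * w)
  | 0 => by
    simp only [pathProd_zero, Nat.cast_zero, zero_mul]
    exact one
  | n + 1 => by
    simp only [pathProd_succ, Nat.cast_succ, add_mul, one_mul]
    exact (pathProd h n).mul (h n)

/-- **The perturbed bond variable** `B ↦ e^{iℓ(B)}·v` (`‖ℓ B‖ ≤ ‖B‖`, `‖v‖, ‖v⁻¹‖ ≤ 1`) is a `LipWord` of weight `1`: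
`e^{iℓ(B)}v − v = (e^{iℓ(B)} − 1)v` and `v⁻¹e^{−iℓ(B)} − v⁻¹ = v⁻¹(e^{−iℓ(B)} − 1)`, `‖e^{a} − 1‖ ≤ e^{‖a‖} − 1`
(`Literature.Analysis.Calculus.norm_exp_sub_one_le`). [folklore] -/
theorem expFactor [CompleteSpace 𝔸] [NormOneClass 𝔸] (ℓ : E →L[ℂ] 𝔸) (hℓ : ∀ B, ‖ℓ B‖ ≤ ‖B‖) {v : 𝔸ˣ}
    (h1 : ‖(v : 𝔸)‖ ≤ 1) (h2 : ‖((v⁻¹ : 𝔸ˣ) : 𝔸)‖ ≤ 1) :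
    LipWord (fun B => expU (Complex.I • ℓ B) * v) 1 where
  expWord := ExpWord.expFactor ℓ hℓ h1 h2
  sub_le B := by
    have hI : ‖Complex.I • ℓ B‖ ≤ ‖B‖ := by rw [norm_smul, Complex.norm_I, one_mul]; exact hℓ B
    have he : ‖exp (Complex.I • ℓ B) - 1‖ ≤ Real.exp ‖B‖ - 1 :=
      (norm_exp_sub_one_le _).trans (sub_le_sub_right (Real.exp_le_exp.2 hI) 1)
    have h0 : 0 ≤ Real.exp ‖B‖ - 1 := by linarith [Real.one_le_exp (norm_nonneg B)]
    rw [Units.val_mul, Units.val_mul, val_expU, val_expU, map_zero, smul_zero, exp_zero, ← sub_mul, one_mul]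
    exact (norm_mul_le _ _).trans ((mul_le_mul he h1 (norm_nonneg _) h0).trans (by rw [mul_one]))
  inv_sub_le B := by
    have hI : ‖-(Complex.I • ℓ B)‖ ≤ ‖B‖ := by rw [norm_neg, norm_smul, Complex.norm_I, one_mul]; exact hℓ B
    have he : ‖exp (-(Complex.I • ℓ B)) - 1‖ ≤ Real.exp ‖B‖ - 1 :=
      (norm_exp_sub_one_le _).trans (sub_le_sub_right (Real.exp_le_exp.2 hI) 1)
    have h0 : 0 ≤ Real.exp ‖B‖ - 1 := by linarith [Real.one_le_exp (norm_nonneg B)]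
    rw [mul_inv_rev, mul_inv_rev, Units.val_mul, Units.val_mul, val_inv_expU, val_inv_expU, map_zero, smul_zero,
      neg_zero, exp_zero, ← mul_sub, one_mul]
    exact (norm_mul_le _ _).trans ((mul_le_mul h2 he (norm_nonneg _) zero_le_one).trans (by rw [one_mul]))

end LipWord

end Summit.QuantumFields.BalabanUV.T4Continuum.ShellMeasureAverageLipschitz
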